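import Summits.ABC.IUTFork.Repair.RLana91InputConstructionArchCorner
import Literature.IUT.LogVolume.LocalDegreeBridge
import HarnessLib

/-!
# REPAIR-CATALOGUE rows RC-130 / RC-639 (H2) — NO p-adic idele output realises Project LANA's (9-1) AS TYPED at the honest-archimedean genuine
# sharp bed: the value group of the rescaled local norms makes every Kummer volume a ℚ-combination of `log|κ(v)|`, and `((l+5)/4)·log π` is
# not one (Lindemann) (D-0123 (C); seat abc-iut-rcat-tst-9 gen 5; closes sub-question (d) of the RC-639 honest-∞ addendum)

PROOF-ONLY file (D-0012; no definition, no `Prop` fact; class `Lana`; rung LADDER-ABC:A2; companion of `Repair.RLana91ArchCorner`,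
`Repair.RLana91InputConstructionArchCorner`). TAKES NO SIDE on [IUTchIII] Cor. 3.12 / [IUTchIV] Thm. 1.10, on the LANA authors, or on any author
or repository; nothing here asserts abc proved or refuted; decided-as-typed ≠ decided-in-print. Row RC-639 (H2) relativises the typed (9-1)
`Repair.CandLana1.H` to a CONSTRUCTION `C : q-ideles ↦ Θ-ideles` feeding abc-iut-c312-7's sharp glue; at the trivial-`∞` bed the q-MOVER output
realises (9-1) (gen 2, p518179), at the honest-`∞` bed it does not (`RLana91InputConstructionArchCorner.not_H_settingPrVolArchSharp_of_norm_eq`),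
which left open whether SOME OTHER output does. THIS FILE closes that: NONE does.

WHAT IS PROVED (ANY pilot data `X` over any number field `F`; the honest-archimedean fourth corner `settingPrVolArchSharp` of abc-iut-c312-7 gen 3
over abc-iut-w5-d163's `∞`-model).
* §1 `exists_int_log_norm_rescaledCompletion` — the VALUE GROUP of abc-iut-S7's rescaled local norm: for `x ≠ 0` in `RescaledCompletion F p v`,
  `log ‖x‖ = (k/n_v)·log|κ(v)|` with `k ∈ ℤ` (`‖·‖ = 𝐍(v)^{−ord_v(·)/n_v}`); §1b a small calculus of the class «some positive integer multiple
  is the log of a positive rational» (`logRat_add/_sum/_mul_of_rat/_log_natCast`, `logRat_log_norm_rescaledCompletion`), which does NOT contain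
  `log π` (`not_logRat_log_pi` — Lindemann 1882, tree `Literature.NumberTheory.Transcendental.transcendental_pi_holds`).
* §2 `logvol_thetaRegion_settingPrVolArchSharp_inr_general` — for ARBITRARY non-zero Θ-ideles (no realising hypothesis) the volume of the sharp
  Kummer image at `(i+1, p)` is `(1/[F:ℚ])·Σ_{v∣p} n_v·log ‖t_{Θ,i+1,v}‖` (abc-iut-c312-7's expectation identity with a free coefficient);
  `logvol_thetaRegion_settingPrVolArchSharp_inr_eq_zero` — it vanishes at primes under no place of `S` when the ideles are units off `S`.
* §2 **`not_H_settingPrVolArchSharp_of_units_off_S`** — for ANY non-zero Θ-ideles that are units off `S` and `q`-ideles realising `P_q`, (9-1) as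
  typed FAILS: by Step (x) it would say that the output's Kummer images have procession volume `−|log q|`
  (`RLana91InputConstructionArchCorner.H_settingPrVolArchSharp_iff_kummerImage`); that volume is `((l+5)/4)·log π` plus an element of the class,
  and `−|log q| = −deĝ̲(P_q)` is in the class — so `log π` would be, i.e. `π^m ∈ ℚ` for some `m ≥ 1`.

READING for the catalogue (numbers and decl names, not adjectives; no side). RC-130 / RC-639 (H2) at the honest-`∞` bed: the identification
family (9-1) as typed is EMPTY across ALL constructions with `p`-adic idele output supported on `S` — faithful (Lindemann on the degree
identity, `RLana91ArchCorner`), q-mover (the archimedean term, `RLana91InputConstructionArchCorner`), or any other (this file: the value group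
`(1/n_v)ℤ·log|κ(v)|` of the local norms against `((l+5)/4)·log π`). The ORDER variant (RC-667) is not empty there (q-mover output, all data;
faithful output, shallow data). HONEST SCOPE: statements about OUR typed objects at OUR beds — c312-7's glue reads the Θ-regions off ideles
through their norms and w5-d163's `∞`-boxes are a MODEL fixed independently of the ideles (an `∞`-component of the construction is not typed);
«units off `S`» is the support condition of every idele family of record in the cell (`ht1`/`htq1`); (9-1) is LANA's self-declared open goal
(§10.5 p. 49) and (H2) is recorded as open among its members (Rmk. 6.2.2 p. 34 l. 8–9) — decided-as-typed ≠ decided-in-print; typed ≠ proved;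
instantiated ≠ endorsed.
[cite: LANA2026Report, Rmk. 6.2.2 p. 33–34; §9.2 (9-1) p. 46; §10.5 p. 49] [cite: Mochizuki2012, IUTchIII Cor. 3.12 p. 173–174; proof Step (x)
p. 181] [cite: Mochizuki2012, IUTchIV Thm. 1.10 proof Step (vii) p. 30] [cite: DupuyHilado2025, §2.5.4, §3.3, §3.4, §3.6, §3.7, §3.9, Thm. 3.10.1]
[cite: NeukirchANT1999, Ch. II Thm. (4.8), Prop. (8.5)] [cite: Lindemann1882, via BakerTNT1975 Ch. 1 Theorem 1.3, p. 5]
[claim: Mochizuki2012, status: disputed] for every quoted construction.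
-/

noncomputable section

open Set Function NumberField IsDedekindDomain

namespace Summit.ABC.IUTFork.Repair.RLana91ArchCornerNoIdeleInput

open Thm311 Thm311.Real Cor312 Cor312Vol Literature.IUT.LogThetaLattice Literature.IUT.LogVolume Literature.IUT.HodgeTheaters
  Literature.NumberTheory.NumberFields RLana91OrderVariant RLana91ArchCorner

/-! ## §1. The value group of the rescaled local norm: `log ‖x‖ ∈ (1/n_v)·ℤ·log|κ(v)|` -/

/-- **`log ‖x‖' = (ord/n_v)·log|κ(v)|` for `x ≠ 0` in abc-iut-S7's rescaled completion** (`‖·‖' = 𝐍(v)^{−ord_v(·)/n_v}`): the logarithm of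
the norm of a non-zero element is an INTEGER multiple of `log|κ(v)|/n_v`. [cite: NeukirchANT1999, Ch. II Thm. (4.8)] -/
theorem exists_int_log_norm_rescaledCompletion {F : Type} [Field F] [NumberField F] (p : ℕ) (v : HeightOneSpectrum (𝓞 F))
    (hv : ((p : ℕ) : 𝓞 F) ∈ v.asIdeal) (x : RescaledCompletion F p v hv) (hx : x ≠ 0) :
    ∃ k : ℤ, Real.log ‖x‖ = (k : ℝ) / (localDeg F v : ℝ) * Real.log (Ideal.absNorm v.asIdeal : ℝ) := by
  have hvx : (Valued.v x : WithZero (Multiplicative ℤ)) ≠ 0 := (Valuation.ne_zero_iff _).2 hx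
  refine ⟨Multiplicative.toAdd (WithZero.unzero hvx), ?_⟩
  have hN : (0 : ℝ) < (Ideal.absNorm v.asIdeal : ℝ) :=
    zero_lt_one.trans (by exact_mod_cast NumberField.HeightOneSpectrum.one_lt_absNorm v)
  rw [RescaledCompletion.norm_def F p v hv x, WithZeroMulInt.toNNReal_neg_apply _ hvx, RescaledCompletion.base, NNReal.coe_zpow,
    NNReal.coe_rpow]
  push_cast
  rw [Real.log_zpow, Real.log_rpow hN]
  ring

/-! ## §1b. «Some positive integer multiple is the log of a positive rational» — a ℚ-span of logarithms of naturals, closed under `+` and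
rational scaling, NOT containing `log π` (Lindemann) -/

/-- Closure under addition. [folklore] -/
theorem logRat_add {r₁ r₂ : ℝ} (h₁ : ∃ m : ℕ, 0 < m ∧ ∃ q : ℚ, 0 < q ∧ (m : ℝ) * r₁ = Real.log (q : ℝ))
    (h₂ : ∃ m : ℕ, 0 < m ∧ ∃ q : ℚ, 0 < q ∧ (m : ℝ) * r₂ = Real.log (q : ℝ)) :
    ∃ m : ℕ, 0 < m ∧ ∃ q : ℚ, 0 < q ∧ (m : ℝ) * (r₁ + r₂) = Real.log (q : ℝ) := by
  obtain ⟨m₁, hm₁, q₁, hq₁, h₁⟩ := h₁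
  obtain ⟨m₂, hm₂, q₂, hq₂, h₂⟩ := h₂
  refine ⟨m₁ * m₂, Nat.mul_pos hm₁ hm₂, q₁ ^ m₂ * q₂ ^ m₁, mul_pos (pow_pos hq₁ _) (pow_pos hq₂ _), ?_⟩
  have hq₁' : (0 : ℝ) < (q₁ : ℝ) := by exact_mod_cast hq₁
  have hq₂' : (0 : ℝ) < (q₂ : ℝ) := by exact_mod_cast hq₂
  push_cast
  rw [Real.log_mul (pow_pos hq₁' _).ne' (pow_pos hq₂' _).ne', Real.log_pow, Real.log_pow, ← h₁, ← h₂]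
  ring

/-- Closure under finite sums. [folklore] -/
theorem logRat_sum {ι : Type} (s : Finset ι) (f : ι → ℝ)
    (h : ∀ i ∈ s, ∃ m : ℕ, 0 < m ∧ ∃ q : ℚ, 0 < q ∧ (m : ℝ) * f i = Real.log (q : ℝ)) :
    ∃ m : ℕ, 0 < m ∧ ∃ q : ℚ, 0 < q ∧ (m : ℝ) * (∑ i ∈ s, f i) = Real.log (q : ℝ) := by
  classical
  induction s using Finset.induction_on with
  | empty => exact ⟨1, Nat.one_pos, 1, one_pos, by simp⟩
  | insert a s ha ih =>
    rw [Finset.sum_insert ha]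
    exact logRat_add (h a (Finset.mem_insert_self a s)) (ih fun i hi => h i (Finset.mem_insert_of_mem hi))

/-- Closure under multiplication by a (real number that is a) rational. [folklore] -/
theorem logRat_mul_of_rat {c r : ℝ} (hc : ∃ a : ℚ, (a : ℝ) = c)
    (h : ∃ m : ℕ, 0 < m ∧ ∃ q : ℚ, 0 < q ∧ (m : ℝ) * r = Real.log (q : ℝ)) :
    ∃ m : ℕ, 0 < m ∧ ∃ q : ℚ, 0 < q ∧ (m : ℝ) * (c * r) = Real.log (q : ℝ) := by
  obtain ⟨a, rfl⟩ := hc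
  obtain ⟨m, hm, q, hq, h⟩ := h
  refine ⟨m * a.den, Nat.mul_pos hm a.den_pos, q ^ a.num, zpow_pos hq _, ?_⟩
  have hq' : (0 : ℝ) < (q : ℝ) := by exact_mod_cast hq
  have hden : ((a.den : ℕ) : ℝ) * (a : ℝ) = (a.num : ℝ) := by
    have h1 : (a : ℚ) * a.den = a.num := Rat.mul_den_eq_num a
    have h2 := congrArg (fun x : ℚ => (x : ℝ)) h1
    push_cast at h2
    linarith
  push_cast
  rw [Real.log_zpow, ← h]
  calc ((m : ℝ) * (a.den : ℝ)) * ((a : ℝ) * r) = (((a.den : ℕ) : ℝ) * (a : ℝ)) * ((m : ℝ) * r) := by ring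
    _ = (a.num : ℝ) * ((m : ℝ) * r) := by rw [hden]

/-- `log N` for a positive natural number `N`. [folklore] -/
theorem logRat_log_natCast {N : ℕ} (hN : 0 < N) :
    ∃ m : ℕ, 0 < m ∧ ∃ q : ℚ, 0 < q ∧ (m : ℝ) * Real.log (N : ℝ) = Real.log (q : ℝ) :=
  ⟨1, Nat.one_pos, N, by exact_mod_cast hN, by push_cast; ring⟩

/-- **`log π` is NOT in the class** (Lindemann 1882: `m·log π = log q` would give `π^m = q ∈ ℚ`; tree
`Literature.NumberTheory.Transcendental.transcendental_pi_holds`). [cite: Lindemann1882, via BakerTNT1975 Ch. 1 Theorem 1.3, p. 5] -/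
theorem not_logRat_log_pi : ¬ ∃ m : ℕ, 0 < m ∧ ∃ q : ℚ, 0 < q ∧ (m : ℝ) * Real.log Real.pi = Real.log (q : ℝ) := by
  rintro ⟨m, hm, q, hq, h⟩
  have hq' : (0 : ℝ) < (q : ℝ) := by exact_mod_cast hq
  rw [← Real.log_pow] at h
  have hpow : Real.pi ^ m = (q : ℝ) := Real.log_injOn_pos (Set.mem_Ioi.2 (pow_pos Real.pi_pos _)) (Set.mem_Ioi.2 hq') h
  have halg : IsAlgebraic ℚ (Real.pi ^ m) := by
    rw [hpow]
    exact isAlgebraic_algebraMap q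
  exact (Literature.NumberTheory.Transcendental.transcendental_pi_holds.pow hm) halg

/-- The log of the rescaled norm of a non-zero local element is in the class (`= (k/n_v)·log|κ(v)|`). [cite: NeukirchANT1999, Ch. II Thm. (4.8)] -/
theorem logRat_log_norm_rescaledCompletion {F : Type} [Field F] [NumberField F] (p : ℕ) (v : HeightOneSpectrum (𝓞 F))
    (hv : ((p : ℕ) : 𝓞 F) ∈ v.asIdeal) (x : RescaledCompletion F p v hv) (hx : x ≠ 0) :
    ∃ m : ℕ, 0 < m ∧ ∃ q : ℚ, 0 < q ∧ (m : ℝ) * Real.log ‖x‖ = Real.log (q : ℝ) := by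
  obtain ⟨k, hk⟩ := exists_int_log_norm_rescaledCompletion p v hv x hx
  rw [hk]
  exact logRat_mul_of_rat ⟨(k : ℚ) / (localDeg F v : ℕ), by push_cast; ring⟩
    (logRat_log_natCast (zero_lt_one.trans (NumberField.HeightOneSpectrum.one_lt_absNorm v)))

section GenuineArch

variable {F : Type} [Field F] [NumberField F] (X : PilotData F) {logv : PadicLogs F} (hlog : LogvAnalytic logv)
  (hc : ∀ w : InfinitePlace F, w.IsComplex) (M : Type) [Field M] [NumberField M]
  (archPk : ∀ (j : (thetaIndex X).Label) (vQ : (thetaIndex X).VQ), Set ((logShellsDH X logv).Packet j vQ))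
  (archSub : ∀ (j : (thetaIndex X).Label) (v : (thetaIndex X).V),
    Set ((logShellsDH X logv).Packet j ((thetaIndex X).over v)))
  (Ψ : ℤ → ∀ v : (thetaIndex X).V, v ∈ (thetaIndex X).Vbad → Set ((logShellsDH X logv).StarPacket v))
  (act : ℤ → ∀ v : (thetaIndex X).V, v ∈ (thetaIndex X).Vbad →
    (logShellsDH X logv).StarPacket v → Module.End ℚ ((logShellsDH X logv).StarPacket v))
  (Mmod : ℤ → ∀ j : (thetaIndex X).LabelStar, Set ((logShellsDH X logv).GlobalPacket j.1))
  (region : ℤ → ∀ j : (thetaIndex X).LabelStar, FinDivisor M → ∀ vQ : (thetaIndex X).VQ,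
    Set ((logShellsDH X logv).Packet j.1 vQ))
  (frobAdm : ℤ → ℤ → ∀ (j : (thetaIndex X).Label) (vQ : (thetaIndex X).VQ),
    Set ((logShellsDH X logv).Packet j vQ) → Prop)
  (frobLogvol : ℤ → ℤ → ∀ (j : (thetaIndex X).Label) (vQ : (thetaIndex X).VQ),
    Set ((logShellsDH X logv).Packet j vQ) → ℝ)
  (frobΨ : ℤ → ℤ → ∀ v : (thetaIndex X).V, v ∈ (thetaIndex X).Vbad → Set ((logShellsDH X logv).StarPacket v))
  (frobMmod : ℤ → ℤ → ∀ j : (thetaIndex X).LabelStar, Set ((logShellsDH X logv).GlobalPacket j.1))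
  (unitImage : ℤ → ℤ → ℕ → ∀ (j : (thetaIndex X).Label) (vQ : (thetaIndex X).VQ),
    Set ((logShellsDH X logv).Packet j vQ))
  (ballImage : ℤ → ℤ → ∀ (j : (thetaIndex X).Label) (vQ : (thetaIndex X).VQ),
    Set ((logShellsDH X logv).Packet j vQ))
  (thetaDiv : ℤ → ℤ → LgpDivisor M (thetaIndex X).lstar)
  (n : ℤ) {HT : Type} {LogLink : HT → HT → Type} {IsFull : ∀ {s t : HT}, LogLink s t → Prop}
  (lat : LGPGaussianLogThetaLattice LogLink IsFull)
  {Frd : Type} {IsoF : Frd → Frd → Type} {Ob : Frd → Type} {realify : Frd → Frd} {Strip : Type}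
  {IsoS : Strip → Strip → Type} {Mv : ∀ v : (thetaIndex X).V, v ∈ (thetaIndex X).Vbad → Type}
  [∀ v h, Monoid (Mv v h)]
  (sig : GlobalLGPFrobenioidSignature (thetaIndex X).lstar (thetaIndex X).V (· ∈ (thetaIndex X).Vbad)
    Frd IsoF Ob realify Strip IsoS Mv)
  (split : SplittingMonoids Mv) {ObΔ : Type} {N : ∀ v : (thetaIndex X).V, v ∈ (thetaIndex X).Vbad → Type}
  [∀ v h, Monoid (N v h)] (qData : QPilotData ObΔ N)
  (t : ∀ (pp : Nat.Primes) (_ : Fin X.lstar) (x : (thetaIndex X).Fibre (.inr pp)),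
    haveI : Fact (pp : ℕ).Prime := ⟨pp.2⟩; kOf X pp.1 x)
  (tq : ∀ (pp : Nat.Primes) (x : (thetaIndex X).Fibre (.inr pp)), haveI : Fact (pp : ℕ).Prime := ⟨pp.2⟩; kOf X pp.1 x)
  (ρ : (∀ v : (thetaIndex X).V, v ∈ (thetaIndex X).Vbad → Set ((logShellsDH X logv).StarPacket v)) →
    ∀ (j : (thetaIndex X).Label) (vQ : (thetaIndex X).VQ), Set ((logShellsDH X logv).Packet j vQ))
  (qK : ∀ v : (thetaIndex X).V, v ∈ (thetaIndex X).Vbad → Set ((logShellsDH X logv).StarPacket v))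

/-! ## §2. The Kummer volume of ARBITRARY non-zero output ideles at a prime: `(1/[F:ℚ])·Σ_{v|p} n_v·log ‖t_{Θ,j,v}‖` -/

/-- **The local volume of the sharp Kummer image at `(i+1, p)` for ARBITRARY non-zero Θ-ideles** (no realising hypothesis):
`(1/[F:ℚ])·Σ_{v ∣ p} n_v·log ‖t_{Θ,i+1,v}‖` — abc-iut-c312-7's expectation identity `logvol_preimage_pi_Pr_of_last` with the coefficient
`c(v) := n_v·log ‖t_{Θ,i+1,v}‖ / log|κ(v)|` (the summand log-measure of the box `ι_j(t)·(R_I)^∼` is `log ‖t‖`, abc-iut-c312-3 `packetLogμ_sharpBoxDH`);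
at a prime the fourth corner's boxes and container are the trivial-`∞` bed's. [cite: DupuyHilado2025, §3.7, §3.9, Thm. 3.10.1] -/
theorem logvol_thetaRegion_settingPrVolArchSharp_inr_general (ht0 : ∀ pp i x, t pp i x ≠ 0) (htq0 : ∀ pp x, tq pp x ≠ 0)
    (htq1 : ∀ (pp : Nat.Primes) (x : (thetaIndex X).Fibre (.inr pp)),
      haveI : Fact (pp : ℕ).Prime := ⟨pp.2⟩; placeOf X pp.1 x ∉ X.S → ‖tq pp x‖ = 1)
    (i : Fin (thetaIndex X).lstar) (pp : Nat.Primes) :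
    haveI : Fact (pp : ℕ).Prime := ⟨pp.2⟩
    ((situationDHVolPrArch X hlog hc M archPk archSub Ψ act Mmod region).D n).logvol (Setting.labelSucc i) (.inr pp)
      ((settingPrVolArchSharp X hlog hc M archPk archSub Ψ act Mmod region n lat sig split qData t tq htq0 htq1).thetaRegion 0
        (Setting.labelSucc i) (.inr pp)) =
      (∑ v ∈ (placesOver F pp).attach,
        (localDegree F v.1 : ℝ) * Real.log ‖t pp i ((fibreEquivPlacesOver X pp).symm v)‖) / Module.finrank ℚ F := by
  haveI : Fact (pp : ℕ).Prime := ⟨pp.2⟩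
  classical
  -- the coefficient function of the expectation identity
  set c : HeightOneSpectrum (𝓞 F) → ℝ := fun v =>
    if h : v ∈ placesOver F pp then
      (localDegree F v : ℝ) * Real.log ‖t pp i ((fibreEquivPlacesOver X pp).symm ⟨v, h⟩)‖ / logNorm F v
    else 0 with hc_def
  -- at a prime, the fourth corner's volume of the Kummer image IS the trivial-∞ bed's
  have hpr : ((situationDHVolPrArch X hlog hc M archPk archSub Ψ act Mmod region).D n).logvol (Setting.labelSucc i) (.inr pp)
      ((settingPrVolArchSharp X hlog hc M archPk archSub Ψ act Mmod region n lat sig split qData t tq htq0 htq1).thetaRegion 0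
        (Setting.labelSucc i) (.inr pp)) =
      (summandPiecesPr X hlog).logvol (Setting.labelSucc i) (.inr pp)
        ((presAtPr X hlog pp).comparison (Setting.labelSucc i) ⁻¹' Set.pi univ (sharpBoxDH X hlog t pp (Setting.labelSucc i))) := by
    rw [← thetaRegion_settingPrVolSharp_inr X hlog M archPk archSub Ψ act Mmod region n lat sig split qData t tq htq0 htq1 0
      (Setting.labelSucc i) pp]
    rfl
  rw [hpr, logvol_preimage_pi_Pr_of_last X hlog pp (Setting.labelSucc i) _ (packetAdm_sharpBoxDH X hlog t ht0 pp _) c (fun e => ?_)]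
  · -- the two coefficient sums agree
    congr 1
    rw [← Finset.sum_attach (placesOver F pp)]
    refine Finset.sum_congr rfl fun v _ => ?_
    have hv : (v : HeightOneSpectrum (𝓞 F)) ∈ placesOver F pp := v.2
    have hln : logNorm F v.1 ≠ 0 := (logNorm_pos F v.1).ne'
    rw [hc_def]
    simp only [dif_pos hv]
    field_simp
  · -- the summand log-measure of the box is `log ‖t‖`, which is `c(v)·log|κ(v)|/n_v` by the choice of `c`
    show packetLogμ pp.1 ((presAt X hlog pp).kk e) (sharpBoxDH X hlog t pp (Setting.labelSucc i) e) = _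
    rw [packetLogμ_sharpBoxDH X hlog t ht0, labelIdele_labelSucc]
    have hmem := placeOf_mem X pp.1 (e (Fin.last _))
    have hln : logNorm F (placeOf X pp.1 (e (Fin.last _))) ≠ 0 := (logNorm_pos F _).ne'
    have hnd : (localDegree F (placeOf X pp.1 (e (Fin.last _))) : ℝ) ≠ 0 := by exact_mod_cast (localDegree_pos F _).ne'
    have hx : (fibreEquivPlacesOver X pp).symm ⟨placeOf X pp.1 (e (Fin.last _)), hmem⟩ = e (Fin.last _) :=
      (fibreEquivPlacesOver X pp).symm_apply_apply _
    rw [hc_def]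
    simp only [dif_pos hmem]
    rw [hx]
    field_simp

/-- **Off the primes under `S` the Kummer images of UNIT ideles have volume `0`** (`log 1 = 0` in every summand).
[cite: DupuyHilado2025, §3.7, §3.9] -/
theorem logvol_thetaRegion_settingPrVolArchSharp_inr_eq_zero (ht0 : ∀ pp i x, t pp i x ≠ 0) (htq0 : ∀ pp x, tq pp x ≠ 0)
    (htq1 : ∀ (pp : Nat.Primes) (x : (thetaIndex X).Fibre (.inr pp)),
      haveI : Fact (pp : ℕ).Prime := ⟨pp.2⟩; placeOf X pp.1 x ∉ X.S → ‖tq pp x‖ = 1)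
    (ht1 : ∀ (pp : Nat.Primes) (i : Fin X.lstar) (x : (thetaIndex X).Fibre (.inr pp)),
      haveI : Fact (pp : ℕ).Prime := ⟨pp.2⟩; placeOf X pp.1 x ∉ X.S → ‖t pp i x‖ = 1)
    (i : Fin (thetaIndex X).lstar) (pp : Nat.Primes)
    (hpp : ∀ v ∈ X.S, haveI : Fact (pp : ℕ).Prime := ⟨pp.2⟩; v ∉ placesOver F pp) :
    ((situationDHVolPrArch X hlog hc M archPk archSub Ψ act Mmod region).D n).logvol (Setting.labelSucc i) (.inr pp)
      ((settingPrVolArchSharp X hlog hc M archPk archSub Ψ act Mmod region n lat sig split qData t tq htq0 htq1).thetaRegion 0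
        (Setting.labelSucc i) (.inr pp)) = 0 := by
  haveI : Fact (pp : ℕ).Prime := ⟨pp.2⟩
  rw [logvol_thetaRegion_settingPrVolArchSharp_inr_general X hlog hc M archPk archSub Ψ act Mmod region n lat sig split qData t tq
    ht0 htq0 htq1 i pp]
  have hzero : ∀ v ∈ (placesOver F pp).attach,
      (localDegree F v.1 : ℝ) * Real.log ‖t pp i ((fibreEquivPlacesOver X pp).symm v)‖ = 0 := by
    intro v _
    have hpl : placeOf X pp.1 ((fibreEquivPlacesOver X pp).symm v) = v.1 :=
      congrArg Subtype.val ((fibreEquivPlacesOver X pp).apply_symm_apply v)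
    have hv : placeOf X pp.1 ((fibreEquivPlacesOver X pp).symm v) ∉ X.S := by
      intro hS
      rw [hpl] at hS
      exact hpp _ hS v.2
    rw [ht1 pp i _ hv, Real.log_one, mul_zero]
  rw [Finset.sum_eq_zero hzero, zero_div]

/-- **NO `p`-ADIC IDELE OUTPUT REALISES (9-1) AS TYPED AT THE HONEST-ARCHIMEDEAN GENUINE SHARP BED.** For ANY non-zero Θ-ideles `t` that are
units off `S` (no realising hypothesis — every construction `C : q-ideles ↦ Θ-ideles` of row RC-639 (H2) with output supported on `S`,
faithful or not, the q-mover included) and `q`-ideles realising `P_q`, the typed (9-1) `Repair.CandLana1.H` FAILS at the fourth corner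
`settingPrVolArchSharp`: by Step (x) it says that the output's Kummer images have procession volume `−|log q|`
(`RLana91InputConstructionArchCorner.H_settingPrVolArchSharp_iff_kummerImage`); that volume is `((l+5)/4)·log π` plus a ℚ-combination of the
`log|κ(v)|` (the value group of abc-iut-S7's rescaled norms, `exists_int_log_norm_rescaledCompletion`; the expectation identity
`logvol_thetaRegion_settingPrVolArchSharp_inr_general`), and `−|log q| = −deĝ̲(P_q)` is such a ℚ-combination too — so (9-1) would put `log π` in
the ℚ-span of logarithms of natural numbers, i.e. `π^m ∈ ℚ` for some `m ≥ 1`, contradicting Lindemann (tree `transcendental_pi_holds`).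
The identification family (9-1) is EMPTY at this bed across all such constructions; the order variant is not (q-mover:
`RLana91InputConstructionArchCorner.orderVariant_settingPrVolArchSharp_of_norm_eq`). Decided-as-typed ≠ decided-in-print (w5-d163's `∞`-boxes are a
MODEL; LANA records (9-1) as its open goal, §10.5 p. 49). [cite: LANA2026Report, Rmk. 6.2.2 p. 33–34; §9.2 (9-1) p. 46; §10.5 p. 49]
[cite: Lindemann1882, via BakerTNT1975 Ch. 1 Theorem 1.3, p. 5] [cite: Mochizuki2012, IUTchIV Thm. 1.10 proof Step (vii) p. 30]
[cite: DupuyHilado2025, §3.3, §3.4, §3.7, §3.9, Thm. 3.10.1] [cite: NeukirchANT1999, Ch. II Thm. (4.8)] -/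
theorem not_H_settingPrVolArchSharp_of_units_off_S (ht0 : ∀ pp i x, t pp i x ≠ 0)
    (ht1 : ∀ (pp : Nat.Primes) (i : Fin X.lstar) (x : (thetaIndex X).Fibre (.inr pp)),
      haveI : Fact (pp : ℕ).Prime := ⟨pp.2⟩; placeOf X pp.1 x ∉ X.S → ‖t pp i x‖ = 1)
    (htq0 : ∀ pp x, tq pp x ≠ 0)
    (htq1 : ∀ (pp : Nat.Primes) (x : (thetaIndex X).Fibre (.inr pp)),
      haveI : Fact (pp : ℕ).Prime := ⟨pp.2⟩; placeOf X pp.1 x ∉ X.S → ‖tq pp x‖ = 1)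
    (htq : ∀ (pp : Nat.Primes) (x : (thetaIndex X).Fibre (.inr pp)),
      haveI : Fact (pp : ℕ).Prime := ⟨pp.2⟩
      Real.log ‖tq pp x‖ = -(X.qPilot (placeOf X pp.1 x)) * logNorm F (placeOf X pp.1 x) /
        localDegree F (placeOf X pp.1 x)) :
    ¬ Repair.CandLana1.H
      (LatticeSituation.ofShells (logShellsDH X logv) M archPk archSub (summandPiecesPrArch X hlog hc).Adm
        (summandPiecesPrArch X hlog hc).logvol Ψ act Mmod region frobAdm frobLogvol frobΨ frobMmod unitImage ballImage thetaDiv)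
      (settingPrVolArchSharp X hlog hc M archPk archSub Ψ act Mmod region n lat sig split qData t tq htq0 htq1) ρ qK := by
  intro hH
  -- `V_ℚ = Unit ⊕ Primes` carries decidable equality (needed for the finite sums below); register it at the folded type too
  letI hdec : DecidableEq (thetaIndex X).VQ := fun a b => instDecidableEqSum a b
  set P := settingPrVolArchSharp X hlog hc M archPk archSub Ψ act Mmod region n lat sig split qData t tq htq0 htq1 with hP
  -- notation: the Kummer volumes `L i v_ℚ`
  set L : Fin (thetaIndex X).lstar → (thetaIndex X).VQ → ℝ := fun i vQ =>
    ((situationDHVolPrArch X hlog hc M archPk archSub Ψ act Mmod region).D n).logvol (Setting.labelSucc i) vQ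
      (P.thetaRegion 0 (Setting.labelSucc i) vQ) with hL
  -- (A) H ⟹ PN(Σᶠ L) = −|log q| = −deĝ̲(P_q)
  have hK : processionNormalized (fun i : Fin (thetaIndex X).lstar => ∑ᶠ vQ : (thetaIndex X).VQ, L i vQ) =
      -FinDivisor.ndeg F X.qPilot := by
    rw [← negLogQ_settingPrVolArchSharp X hlog hc M archPk archSub Ψ act Mmod region n lat sig split qData t tq htq0 htq1 htq]
    exact (RLana91InputConstructionArchCorner.H_settingPrVolArchSharp_iff_kummerImage X hlog hc M archPk archSub Ψ act Mmod region
      frobAdm frobLogvol frobΨ frobMmod unitImage ballImage thetaDiv n lat sig split qData t tq ρ qK ht0 htq0 htq1).1 hH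
  -- (B) the support of `L i` lies in `{∞} ∪ {primes under S}`
  have hinl : (Sum.inl () : Unit ⊕ Nat.Primes) ∉ (X.S.image fun v => (Sum.inr ⟨residueChar F v, residueChar_prime F v⟩ : Unit ⊕ Nat.Primes)) := by
    intro h
    obtain ⟨v, -, hv⟩ := Finset.mem_image.1 h
    exact Sum.inr_ne_inl hv
  have hsupp : ∀ i : Fin (thetaIndex X).lstar,
      (Function.support fun vQ => L i vQ) ⊆
        ((insert (Sum.inl ()) (X.S.image fun v => (Sum.inr ⟨residueChar F v, residueChar_prime F v⟩ : Unit ⊕ Nat.Primes)) : Finset (Unit ⊕ Nat.Primes)) : Set (Unit ⊕ Nat.Primes)) := by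
    intro i vQ hvQ
    rcases vQ with u | pp
    · cases u
      exact Finset.mem_coe.2 (Finset.mem_insert_self _ _)
    · refine Finset.mem_coe.2 (Finset.mem_insert_of_mem ?_)
      by_contra hne
      apply hvQ
      haveI : Fact (pp : ℕ).Prime := ⟨pp.2⟩
      refine logvol_thetaRegion_settingPrVolArchSharp_inr_eq_zero X hlog hc M archPk archSub Ψ act Mmod region n lat sig split
        qData t tq ht0 htq0 htq1 ht1 i pp fun v hv hmem => hne (Finset.mem_image.2 ⟨v, hv, ?_⟩)
      have hres : residueChar F v = (pp : ℕ) := (mem_placesOver_iff_residueChar v).1 hmem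
      exact congrArg Sum.inr (Subtype.ext hres)
  -- (C) hence `Σᶠ L i = |S^±_{i+2}|·log π + Σ_{primes under S} L i`
  have hF : ∀ i : Fin (thetaIndex X).lstar, ∑ᶠ vQ : (thetaIndex X).VQ, L i vQ =
      (Fintype.card ((thetaIndex X).Caps (Setting.labelSucc i)) : ℝ) * Real.log Real.pi + ∑ vQ ∈ (X.S.image fun v => (Sum.inr ⟨residueChar F v, residueChar_prime F v⟩ : Unit ⊕ Nat.Primes)), L i vQ := by
    intro i
    refine (finsum_eq_sum_of_support_subset _ (hsupp i)).trans ((Finset.sum_insert hinl).trans ?_)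
    exact congrArg (· + ∑ vQ ∈ (X.S.image fun v => (Sum.inr ⟨residueChar F v, residueChar_prime F v⟩ : Unit ⊕ Nat.Primes)), L i vQ)
      (logvol_thetaRegion_settingPrVolArchSharp_inl X hlog hc M archPk archSub Ψ act Mmod region n lat sig split qData t tq htq0 htq1
        0 (Setting.labelSucc i))
  -- (D) the prime part is a ℚ-combination of logarithms of naturals
  have hR : ∀ i : Fin (thetaIndex X).lstar,
      ∃ m : ℕ, 0 < m ∧ ∃ q : ℚ, 0 < q ∧ (m : ℝ) * (∑ vQ ∈ (X.S.image fun v => (Sum.inr ⟨residueChar F v, residueChar_prime F v⟩ : Unit ⊕ Nat.Primes)), L i vQ) = Real.log (q : ℝ) := by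
    intro i
    refine logRat_sum _ (fun vQ => L i vQ) fun vQ hvQ => ?_
    obtain ⟨v, -, rfl⟩ := Finset.mem_image.1 hvQ
    haveI : Fact (residueChar F v).Prime := ⟨residueChar_prime F v⟩
    have hLi : L i (Sum.inr ⟨residueChar F v, residueChar_prime F v⟩ : Unit ⊕ Nat.Primes) =
        (∑ w ∈ (placesOver F (residueChar F v)).attach,
          (localDegree F w.1 : ℝ) *
            Real.log ‖t ⟨residueChar F v, residueChar_prime F v⟩ i
              ((fibreEquivPlacesOver X ⟨residueChar F v, residueChar_prime F v⟩).symm w)‖) / Module.finrank ℚ F :=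
      logvol_thetaRegion_settingPrVolArchSharp_inr_general X hlog hc M archPk archSub Ψ act Mmod region n lat sig split qData t tq
        ht0 htq0 htq1 i ⟨residueChar F v, residueChar_prime F v⟩
    show ∃ m : ℕ, 0 < m ∧ ∃ q : ℚ, 0 < q ∧
      (m : ℝ) * L i (Sum.inr ⟨residueChar F v, residueChar_prime F v⟩ : Unit ⊕ Nat.Primes) = Real.log (q : ℝ)
    rw [hLi, div_eq_inv_mul]
    refine logRat_mul_of_rat ⟨((Module.finrank ℚ F : ℕ) : ℚ)⁻¹, by push_cast; ring⟩ (logRat_sum _ _ fun w _ => ?_)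
    exact logRat_mul_of_rat ⟨(localDegree F w.1 : ℚ), by push_cast; ring⟩
      (logRat_log_norm_rescaledCompletion _ _ _ (t _ i _) (ht0 _ i _))
  -- (E) `PN(Σᶠ L) = ((l+5)/4)·log π + PN(prime parts)`, the latter in the class
  have hPN : processionNormalized (fun i : Fin (thetaIndex X).lstar => ∑ᶠ vQ : (thetaIndex X).VQ, L i vQ) =
      ThetaVolumeInput.archLogTheta X.l + processionNormalized (fun i : Fin (thetaIndex X).lstar => ∑ vQ ∈ (X.S.image fun v => (Sum.inr ⟨residueChar F v, residueChar_prime F v⟩ : Unit ⊕ Nat.Primes)), L i vQ) := by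
    rw [show (fun i : Fin (thetaIndex X).lstar => ∑ᶠ vQ : (thetaIndex X).VQ, L i vQ) =
        fun i : Fin (thetaIndex X).lstar =>
          (Fintype.card ((thetaIndex X).Caps (Setting.labelSucc i)) : ℝ) * Real.log Real.pi + ∑ vQ ∈ (X.S.image fun v => (Sum.inr ⟨residueChar F v, residueChar_prime F v⟩ : Unit ⊕ Nat.Primes)), L i vQ from funext hF,
      Repair.CandDupuyHilado31.processionNormalized_add, processionNormalized_card_caps_log_pi_eq_archLogTheta X]
  have hPNR : ∃ m : ℕ, 0 < m ∧ ∃ q : ℚ, 0 < q ∧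
      (m : ℝ) * processionNormalized (fun i : Fin (thetaIndex X).lstar => ∑ vQ ∈ (X.S.image fun v => (Sum.inr ⟨residueChar F v, residueChar_prime F v⟩ : Unit ⊕ Nat.Primes)), L i vQ) = Real.log (q : ℝ) := by
    unfold processionNormalized
    rw [div_eq_inv_mul]
    exact logRat_mul_of_rat ⟨(((thetaIndex X).lstar : ℕ) : ℚ)⁻¹, by push_cast; ring⟩ (logRat_sum _ _ fun i _ => hR i)
  -- (F) `deĝ̲(P_q) = (1/[F:ℚ])·(1/2l)·Σ_{v∈S} ord_v(q_v)·log|κ(v)|` is in the class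
  have hq : ∃ m : ℕ, 0 < m ∧ ∃ q : ℚ, 0 < q ∧ (m : ℝ) * FinDivisor.ndeg F X.qPilot = Real.log (q : ℝ) := by
    rw [FinDivisor.ndeg_apply, X.deg_qPilot, X.deg_qDivisor, div_eq_inv_mul]
    refine logRat_mul_of_rat ⟨((Module.finrank ℚ F : ℕ) : ℚ)⁻¹, by push_cast; ring⟩
      (logRat_mul_of_rat ⟨1 / (2 * (X.l : ℚ)), by push_cast; ring⟩ (logRat_sum _ _ fun v _ => ?_))
    exact logRat_mul_of_rat ⟨(X.ordq v : ℚ), by push_cast; ring⟩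
      (logRat_log_natCast (zero_lt_one.trans (NumberField.HeightOneSpectrum.one_lt_absNorm v)))
  -- (G) so `((l+5)/4)·log π`, hence `log π`, would be in the class — contradicting Lindemann
  have hA : ∃ m : ℕ, 0 < m ∧ ∃ q : ℚ, 0 < q ∧ (m : ℝ) * ThetaVolumeInput.archLogTheta X.l = Real.log (q : ℝ) := by
    have hEq : ThetaVolumeInput.archLogTheta X.l =
        (-1 : ℝ) * FinDivisor.ndeg F X.qPilot +
          (-1 : ℝ) * processionNormalized (fun i : Fin (thetaIndex X).lstar => ∑ vQ ∈ (X.S.image fun v => (Sum.inr ⟨residueChar F v, residueChar_prime F v⟩ : Unit ⊕ Nat.Primes)), L i vQ) := by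
      linarith [hK, hPN]
    rw [hEq]
    exact logRat_add (logRat_mul_of_rat ⟨-1, by push_cast; ring⟩ hq) (logRat_mul_of_rat ⟨-1, by push_cast; ring⟩ hPNR)
  have hl5 : (0 : ℝ) < (X.l : ℝ) + 5 := by positivity
  have hpi : ∃ m : ℕ, 0 < m ∧ ∃ q : ℚ, 0 < q ∧ (m : ℝ) * Real.log Real.pi = Real.log (q : ℝ) := by
    have hEq : Real.log Real.pi = (4 / ((X.l : ℝ) + 5)) * ThetaVolumeInput.archLogTheta X.l := by
      rw [ThetaVolumeInput.archLogTheta]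
      field_simp
    rw [hEq]
    exact logRat_mul_of_rat ⟨4 / ((X.l : ℚ) + 5), by push_cast; ring⟩ hA
  exact not_logRat_log_pi hpi


end GenuineArch

end Summit.ABC.IUTFork.Repair.RLana91ArchCornerNoIdeleInput

end
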